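import Summits.QuantumFields.YangMills.Theorems.RationalShortRootRigidityGivensInvariance
import HarnessLib

/-!
# `RationalShortRootRigidity` — Step 3 of the paper proof, part II: `W(B₄)` + the 60°-plane rotations force radiality

Helper for crux `stmt-QuantumFields-23124` (`F4SubCurvatureDoor.RationalShortRootRigidity`, LINE g15-A of planner
ym-idea-3; paper proof HOME l15/RATIONAL-SHORT-ROOT-RIGIDITY.md, birth skeleton l15/RationalShortRootRigidity-birth.lean).
It is the skeleton's Step 3 (`stub_so4 : ∀ D₀, IsB4Inv D₀ → PlaneRotInv D₀ → Radial D₀`) with the two hypotheses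
UNFOLDED verbatim (the skeleton's `rotPlane` inlined), so that a registered stub closes by `exact`:

**Theorem** (`radial_of_b4Inv_of_planeRotInv`).  Let `D ∈ ℝ[p₀,…,p₃]` be invariant (as a function on `ℝ⁴`) under all
signed coordinate permutations and under the one-parameter group of rotations of the plane `span(e₀, (e₁+e₂+e₃)/√3)`
(identity on its orthogonal complement).  Then `D(p) = F(Σpᵢ²)` for a polynomial `F`.

Part I (`RationalShortRootRigidityGivensInvariance.lean`) derived invariance under the three coordinate Givens families
`G₀ᵢ(θ)` (`eval_givens`).  Here: three eliminations (`θ = arg(p₀ − i·pᵢ)`) give `D(p) = D(√(Σpᵢ²)·e₀) = g(√(Σpᵢ²))` with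
`g(t) = D(t e₀) ∈ ℝ[t]` EVEN (sign flip `(−1,1,1,1)`), and an even polynomial is a polynomial in `t²`
(`exists_polynomial_sq_of_even`).

Mathlib only (via part I); THEOREMS ONLY (no definitions).  Nothing about the Yang–Mills mass gap is proved; the crux
(which needs also Steps 1, 2, 4) stays open.  Free-hands width seat `ym-line-sfw-p2-w4` (cell ym-idea-1).
-/

set_option autoImplicit false

namespace Summit.QuantumFields.YangMills.Theorems.RationalShortRootRigidity

open MvPolynomial Finset
open scoped BigOperators Polynomial

/-! ## 4. Elimination to the axis and the even univariate restriction -/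

/-- One elimination: for `i ≠ 0` there is an angle moving the pair `(p₀, pᵢ)` to `(√(p₀²+pᵢ²), 0)`. [folklore] -/
theorem exists_givens_elim (a b : ℝ) :
    ∃ θ : ℝ, Real.cos θ * a - Real.sin θ * b = Real.sqrt (a ^ 2 + b ^ 2) ∧ Real.sin θ * a + Real.cos θ * b = 0 := by
  by_cases hz : (⟨a, -b⟩ : ℂ) = 0
  · have ha : a = 0 := by have := congrArg Complex.re hz; simpa using this
    have hb : b = 0 := by have := congrArg Complex.im hz; simpa using this
    refine ⟨0, ?_, ?_⟩ <;> simp [ha, hb]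
  · set s : ℝ := Real.sqrt (a ^ 2 + b ^ 2) with hs_def
    have hn : ‖(⟨a, -b⟩ : ℂ)‖ = s := by
      rw [Complex.norm_eq_sqrt_sq_add_sq, hs_def]
      simp only [neg_sq]
    have hpos : 0 < s := by rw [← hn]; exact norm_pos_iff.mpr hz
    have hs2 : s * s = a ^ 2 + b ^ 2 := Real.mul_self_sqrt (by positivity)
    have hs0 : s ≠ 0 := hpos.ne'
    have hc : Real.cos (Complex.arg ⟨a, -b⟩) = a / s := by rw [Complex.cos_arg hz, hn]
    have hsn : Real.sin (Complex.arg ⟨a, -b⟩) = -b / s := by rw [Complex.sin_arg, hn]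
    refine ⟨Complex.arg ⟨a, -b⟩, ?_, ?_⟩
    · rw [hc, hsn]
      have : a / s * a - -b / s * b = (a ^ 2 + b ^ 2) / s := by
        rw [div_mul_eq_mul_div, div_mul_eq_mul_div, ← sub_div]
        ring
      rw [this, div_eq_iff hs0, ← hs2]
    · rw [hc, hsn, div_mul_eq_mul_div, div_mul_eq_mul_div, ← add_div]
      have : -b * a + a * b = 0 := by ring
      rw [this, zero_div]

/-- `D(p) = D(√(Σpᵢ²)·e₀)`. [folklore] -/
theorem eval_eq_eval_axis (D : MvPolynomial (Fin 4) ℝ)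
    (hB4 : ∀ (σ : Equiv.Perm (Fin 4)) (ε : Fin 4 → ℝ), (∀ i, ε i = 1 ∨ ε i = -1) →
      ∀ p : Fin 4 → ℝ, MvPolynomial.eval (fun i => ε i * p (σ i)) D = MvPolynomial.eval p D)
    (hrot : ∀ (φ : ℝ) (p : Fin 4 → ℝ), MvPolynomial.eval (fun i => if i = 0 then
        Real.cos φ * p 0 - Real.sin φ * ((p 1 + p 2 + p 3) / Real.sqrt 3)
      else p i + ((Real.sin φ * p 0 + Real.cos φ * ((p 1 + p 2 + p 3) / Real.sqrt 3)) -
        (p 1 + p 2 + p 3) / Real.sqrt 3) / Real.sqrt 3) D = MvPolynomial.eval p D)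
    (p : Fin 4 → ℝ) :
    MvPolynomial.eval p D =
      MvPolynomial.eval (fun k : Fin 4 => if k = 0 then Real.sqrt (∑ i, p i ^ 2) else 0) D := by
  -- eliminate coordinate 3, then 2, then 1
  obtain ⟨θ₃, hc₃, hs₃⟩ := exists_givens_elim (p 0) (p 3)
  have e3 := eval_givens D hB4 hrot 3 (by decide) p θ₃
  set p₃ : Fin 4 → ℝ := fun k => if k = 0 then Real.cos θ₃ * p 0 - Real.sin θ₃ * p 3
      else if k = 3 then Real.sin θ₃ * p 0 + Real.cos θ₃ * p 3 else p k with hp₃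
  obtain ⟨θ₂, hc₂, hs₂⟩ := exists_givens_elim (p₃ 0) (p₃ 2)
  have e2 := eval_givens D hB4 hrot 2 (by decide) p₃ θ₂
  set p₂ : Fin 4 → ℝ := fun k => if k = 0 then Real.cos θ₂ * p₃ 0 - Real.sin θ₂ * p₃ 2
      else if k = 2 then Real.sin θ₂ * p₃ 0 + Real.cos θ₂ * p₃ 2 else p₃ k with hp₂
  obtain ⟨θ₁, hc₁, hs₁⟩ := exists_givens_elim (p₂ 0) (p₂ 1)
  have e1 := eval_givens D hB4 hrot 1 (by decide) p₂ θ₁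
  set p₁ : Fin 4 → ℝ := fun k => if k = 0 then Real.cos θ₁ * p₂ 0 - Real.sin θ₁ * p₂ 1
      else if k = 1 then Real.sin θ₁ * p₂ 0 + Real.cos θ₁ * p₂ 1 else p₂ k with hp₁
  -- compute the final point
  have h30 : p₃ 0 = Real.sqrt (p 0 ^ 2 + p 3 ^ 2) := by simp [hp₃, hc₃]
  have h33 : p₃ 3 = 0 := by simp [hp₃, hs₃]
  have h31 : p₃ 1 = p 1 := by simp [hp₃]
  have h32 : p₃ 2 = p 2 := by simp [hp₃]
  have h20 : p₂ 0 = Real.sqrt (p₃ 0 ^ 2 + p₃ 2 ^ 2) := by simp [hp₂, hc₂]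
  have h22 : p₂ 2 = 0 := by simp [hp₂, hs₂]
  have h21 : p₂ 1 = p₃ 1 := by simp [hp₂]
  have h23 : p₂ 3 = p₃ 3 := by simp [hp₂]
  have h10 : p₁ 0 = Real.sqrt (p₂ 0 ^ 2 + p₂ 1 ^ 2) := by simp [hp₁, hc₁]
  have h11 : p₁ 1 = 0 := by simp [hp₁, hs₁]
  have h12 : p₁ 2 = p₂ 2 := by simp [hp₁]
  have h13 : p₁ 3 = p₂ 3 := by simp [hp₁]
  have hsum : p₂ 0 ^ 2 + p₂ 1 ^ 2 = ∑ i, p i ^ 2 := by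
    rw [h20, h21, Real.sq_sqrt (by positivity), h30, h31, h32, Real.sq_sqrt (by positivity), Fin.sum_univ_four]
    ring
  have h10' : p₁ 0 = Real.sqrt (∑ i, p i ^ 2) := by rw [h10, hsum]
  have h12' : p₁ 2 = 0 := by rw [h12, h22]
  have h13' : p₁ 3 = 0 := by rw [h13, h23, h33]
  have hpt : p₁ = fun k : Fin 4 => if k = 0 then Real.sqrt (∑ i, p i ^ 2) else 0 := by
    funext k
    fin_cases k <;> simp [h10', h11, h12', h13']
  rw [← e3, ← e2, ← e1, hpt]

/-- Splitting a sum over `range (2n)` into even and odd indices. [folklore] -/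
theorem sum_range_two_mul (f : ℕ → ℝ) (n : ℕ) :
    ∑ k ∈ Finset.range (2 * n), f k = ∑ j ∈ Finset.range n, f (2 * j) + ∑ j ∈ Finset.range n, f (2 * j + 1) := by
  induction n with
  | zero => simp
  | succ n ih =>
      rw [show 2 * (n + 1) = 2 * n + 1 + 1 by ring, Finset.sum_range_succ, Finset.sum_range_succ, ih,
        Finset.sum_range_succ, Finset.sum_range_succ]
      ring

/-- An even real polynomial is a polynomial in the square: if `g(−t) = g(t)` for all `t` then `g(t) = F(t²)`.
[folklore] -/
theorem exists_polynomial_sq_of_even (g : Polynomial ℝ) (heven : ∀ t : ℝ, g.eval (-t) = g.eval t) :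
    ∃ F : Polynomial ℝ, ∀ t : ℝ, g.eval t = F.eval (t ^ 2) := by
  set n : ℕ := g.natDegree + 1 with hn
  refine ⟨∑ j ∈ Finset.range n, Polynomial.C (g.coeff (2 * j)) * Polynomial.X ^ j, fun t => ?_⟩
  have hlt : g.natDegree < 2 * n := by omega
  have hexp : ∀ u : ℝ, g.eval u = ∑ j ∈ Finset.range n, g.coeff (2 * j) * u ^ (2 * j) +
      ∑ j ∈ Finset.range n, g.coeff (2 * j + 1) * u ^ (2 * j + 1) := by
    intro u
    rw [Polynomial.eval_eq_sum_range' hlt, sum_range_two_mul (fun k => g.coeff k * u ^ k) n]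
  -- the odd part vanishes
  have hodd : ∑ j ∈ Finset.range n, g.coeff (2 * j + 1) * t ^ (2 * j + 1) = 0 := by
    have h := heven t
    rw [hexp, hexp] at h
    have he : ∀ j : ℕ, (-t) ^ (2 * j) = t ^ (2 * j) := fun j => by rw [pow_mul, neg_sq, ← pow_mul]
    have ho : ∀ j : ℕ, (-t) ^ (2 * j + 1) = -t ^ (2 * j + 1) := fun j => by
      rw [pow_succ, pow_succ, he]; ring
    simp only [he, ho, mul_neg, Finset.sum_neg_distrib] at h
    linarith
  rw [hexp, hodd, add_zero, Polynomial.eval_finsetSum]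
  refine Finset.sum_congr rfl fun j _ => ?_
  rw [Polynomial.eval_mul, Polynomial.eval_C, Polynomial.eval_pow, Polynomial.eval_X, ← pow_mul]

/-- The axis restriction `t ↦ D(t e₀)` as a univariate polynomial: evaluation. [folklore] -/
theorem eval_axisPoly (D : MvPolynomial (Fin 4) ℝ) (t : ℝ) :
    (MvPolynomial.aeval (fun i : Fin 4 => if i = 0 then (Polynomial.X : ℝ[X]) else 0) D).eval t =
      MvPolynomial.eval (fun k : Fin 4 => if k = 0 then t else 0) D := by
  induction D using MvPolynomial.induction_on with
  | C a => simp
  | add p q hp hq => simp only [map_add, Polynomial.eval_add, hp, hq]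
  | mul_X p i hp =>
      rw [map_mul, map_mul, Polynomial.eval_mul, hp, MvPolynomial.aeval_X, MvPolynomial.eval_X]
      by_cases hi : i = 0
      · subst hi; simp
      · simp [hi]

/-! ## The theorem -/

/-- **Step 3 of the rational short-root rigidity proof** (= the birth skeleton's `stub_so4`, hypotheses unfolded):
a polynomial on `ℝ⁴` invariant under signed coordinate permutations and under the rotations of the plane
`span(e₀, (e₁+e₂+e₃)/√3)` is a polynomial in `Σpᵢ²`. [folklore] -/
theorem radial_of_b4Inv_of_planeRotInv (D : MvPolynomial (Fin 4) ℝ)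
    (hB4 : ∀ (σ : Equiv.Perm (Fin 4)) (ε : Fin 4 → ℝ), (∀ i, ε i = 1 ∨ ε i = -1) →
      ∀ p : Fin 4 → ℝ, MvPolynomial.eval (fun i => ε i * p (σ i)) D = MvPolynomial.eval p D)
    (hrot : ∀ (φ : ℝ) (p : Fin 4 → ℝ), MvPolynomial.eval (fun i =>
      let a := p 0
      let b := (p 1 + p 2 + p 3) / Real.sqrt 3
      if i = 0 then Real.cos φ * a - Real.sin φ * b
      else p i + ((Real.sin φ * a + Real.cos φ * b) - b) / Real.sqrt 3) D = MvPolynomial.eval p D) :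
    ∃ F : Polynomial ℝ, ∀ p : Fin 4 → ℝ, MvPolynomial.eval p D = F.eval (∑ i, p i ^ 2) := by
  have hrot' : ∀ (φ : ℝ) (p : Fin 4 → ℝ), MvPolynomial.eval (fun i => if i = 0 then
        Real.cos φ * p 0 - Real.sin φ * ((p 1 + p 2 + p 3) / Real.sqrt 3)
      else p i + ((Real.sin φ * p 0 + Real.cos φ * ((p 1 + p 2 + p 3) / Real.sqrt 3)) -
        (p 1 + p 2 + p 3) / Real.sqrt 3) / Real.sqrt 3) D = MvPolynomial.eval p D := hrot
  -- the even axis polynomial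
  set g : ℝ[X] := MvPolynomial.aeval (fun i : Fin 4 => if i = 0 then (Polynomial.X : ℝ[X]) else 0) D with hg
  have heven : ∀ t : ℝ, g.eval (-t) = g.eval t := by
    intro t
    rw [eval_axisPoly, eval_axisPoly]
    have h := hB4 (Equiv.refl _) ![-1, 1, 1, 1] (by intro j; fin_cases j <;> simp)
      (fun k : Fin 4 => if k = 0 then t else 0)
    simp only [Equiv.refl_apply] at h
    have hpt : (fun k : Fin 4 => if k = 0 then -t else 0) =
        fun i : Fin 4 => ![-1, 1, 1, 1] i * (if i = 0 then t else 0) := by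
      funext k
      fin_cases k <;> simp
    rw [hpt]
    exact h
  obtain ⟨F, hF⟩ := exists_polynomial_sq_of_even g heven
  refine ⟨F, fun p => ?_⟩
  rw [eval_eq_eval_axis D hB4 hrot' p, ← eval_axisPoly, hF, Real.sq_sqrt (Finset.sum_nonneg fun i _ => sq_nonneg _)]

end Summit.QuantumFields.YangMills.Theorems.RationalShortRootRigidity
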